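import Summits.QuantumFields.BalabanUV.T4Continuum.Support.NE9PolydiscStepOffCentreSharp
import Summits.QuantumFields.BalabanUV.T4Continuum.Support.NE9PolydiscChainOffCentre

/-!
# NE9PolydiscChainOffCentreSharp — ROUTE R4♯-T, PIECE (T-a), SHARPNESS IN THE REGISTERED CURRENCY: PART 2's rate
# inequality `hμ` is NECESSARY for `ChainLipschitz S W r θ Cc μ` on the Schwarz–Pick class, at EVERY prefactor `Cc`
# (crux refuter O-v12-1, PRICING-NE9 v12 §H; OWNER t4-ne9-p1 g63 WORD W1 (b), journal l.30560 «(3) … ONE ≤ 150-line corollary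
# module importing leaf-04's `NE9PolydiscStepOffCentreSharp` BY NAME; no second Möbius construction»; cell `pub-balaban`, T4-DAG
# §2 node U3 ∕ §6 NE9; unit `b2b-balaban-t4-ne9-formalise-leaf-03`, generation 46; Summits-side NEW work on leaf-04 g51's
# `rateIneq_of_classChainBound` p263720 and the lineage's PART 2 `NE9PolydiscChainOffCentre` p260839; 0 `def`, 0 sorry)

HONEST FRAMING (T4-DAG PAGE 1).  Rung (B)+1 of the FINITE-VOLUME T⁴ programme — NOT infinite volume, NOT a mass gap, NOT
the Clay problem.  NE9 (`T4OutputRate.NE9` ∧ `FadingMemory`) is a cell NEW ESTIMATE, NOT PRINTED in [I] = CMP **109**, [II] =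
CMP **116**, NOT PROVED here or anywhere («NE9 ⇐ the named binders»; WALLED ON A MODEL O-NE9-1; spine PROVED 0∕9).  Generic
bookkeeping (a dilation; `evol` of a constant step sequence) around leaf-04's one-variable Möbius witness; no Bałaban object;
necessity of a RATE hypothesis inside a CONDITIONAL END is pricing bookkeeping, NOT progress on the estimate.  HONEST
DEPENDENCY (cell line, verbatim): continuum YM on T⁴ ⇐ BetaPertH ∧ nine spine estimates (0/9 proved); BetaPertH ⇐ (D1) ∧
(D4) ∧ CAP+tail; G-an2-4 gates asym, D1 and NE2/3/4.

WHAT (0 sorry).  `evol_const`; **`exists_offCentreMaps_not_chainLipschitz`** — PART 2's `chainLipschitz_of_holoMaps_offCentre`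
at `𝔛 = ℓ^∞(A;ℂ)` (`A`, `W` inhabited, `0 ≤ c̄`) with `hμ` NEGATED yields CONSTANT holomorphic step maps in the class (the
dilation `z ↦ r·F(z∕r)` of leaf-04's unit-ball witness, by contraposition of `rateIneq_of_classChainBound`) with
`¬ ChainLipschitz S W r θ Cc μ`, every `Cc`; **`rateIneq_iff_forall_chainLipschitz`** — in PART 2's currency `hμ` is NECESSARY
AND SUFFICIENT for `ChainLipschitz S W r θ (1∕(1−θ²)) μ` on the class (least such `μ` = leaf-04's closed form,
`NE9PolydiscRateLeast.isLeast_rate_radius`).  DISGUISE TEST: no Bałaban object; not NE9.  DOES NOT: say anything on the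
optimality of the END's rate for Bałaban's terms (T15's analogue), (T-b)∕(T-c)∕K2, O-NE9-1, `z`, `S`; no END re-wired.
[FV1980] Franzoni–Vesentini, North-Holland Math. Studies 40 (1980), ch. V — TYPES ∕ loci only; nothing asserted.
-/

noncomputable section

namespace Summit.QuantumFields.BalabanUV.T4Continuum.NE9PolydiscChainOffCentreSharp

open Metric Set
open scoped ENNReal
open Summit.QuantumFields.BalabanUV.T4Continuum.NE9EarleHamiltonChain (evol evol_of_le evol_succ_apply
  ChainLipschitz)
open Summit.QuantumFields.BalabanUV.T4Continuum.NE9PolydiscRateLeast (rateIneq_iff_unit)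
open Summit.QuantumFields.BalabanUV.T4Continuum.NE9PolydiscStepOffCentreSharp (rateIneq_of_classChainBound)
open Summit.QuantumFields.BalabanUV.T4Continuum.NE9PolydiscChainOffCentre (chainLipschitz_of_holoMaps_offCentre)

variable {A : Type*}

/-- `evol` of a CONSTANT step sequence `S j = F` is the iterate: `evol (fun _ ↦ F) i K = F^[K − i]`. [folklore] -/
theorem evol_const {𝔛 : Type*} (F : 𝔛 → 𝔛) (i K : ℕ) : evol (fun _ => F) i K = F^[K - i] := by
  induction K with
  | zero => rw [evol_of_le (Nat.zero_le i), Nat.zero_sub, Function.iterate_zero]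
  | succ K ih =>
    rcases le_or_gt i K with h | h
    · funext z
      rw [evol_succ_apply h, ih]
      show F (F^[K - i] z) = F^[K + 1 - i] z
      rw [Nat.sub_add_comm h, Function.iterate_succ_apply']
    · rw [evol_of_le (by omega), Nat.sub_eq_zero_of_le (by omega), Function.iterate_zero]

/-- **(T-a)'s RATE INEQUALITY IS NECESSARY IN THE REGISTERED CURRENCY.**  PART 2's `chainLipschitz_of_holoMaps_offCentre`
at `𝔛 = ℓ^∞(A;ℂ)` (`A` inhabited by `β`, `W` inhabited, `0 ≤ c̄`) with `hμ` NEGATED — `μ·r₄·(r² − (c̄+ρ)²) < (r₄² − ρ²)·r`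
at some `ρ ∈ [0, r₄]` — yields CONSTANT holomorphic step maps `S k g : B(0,r) → B̄(c k g, r₄)`, `‖c k g‖ ≤ c̄` (the dilation
`z ↦ r·F(z∕r)` of leaf-04's coordinate-Möbius witness, by contraposition of `rateIneq_of_classChainBound`) for which
`ChainLipschitz S W r θ Cc μ` FAILS — at EVERY prefactor `Cc`, not only `1∕(1−θ²)`. [folklore; FV1980 ch. V] -/
theorem exists_offCentreMaps_not_chainLipschitz (β : A) {W : Set (ℕ → ℝ)} (hW : W.Nonempty)
    {r cbar r₄ θ μ Cc : ℝ} (hr : 0 < r) (hcbar : 0 ≤ cbar) (hr₄ : 0 < r₄) (hθ : cbar + r₄ ≤ θ * r) (hθ1 : θ < 1)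
    (hμ : ∃ ρ ∈ Icc (0 : ℝ) r₄, μ * r₄ * (r ^ 2 - (cbar + ρ) ^ 2) < (r₄ ^ 2 - ρ ^ 2) * r) :
    ∃ (S : ℕ → (ℕ → ℝ) → lp (fun _ : A => ℂ) ∞ → lp (fun _ : A => ℂ) ∞)
      (c : ℕ → (ℕ → ℝ) → lp (fun _ : A => ℂ) ∞),
      (∀ k, ∀ g ∈ W, DifferentiableOn ℂ (S k g) (ball (0 : lp (fun _ : A => ℂ) ∞) r)) ∧
      (∀ k, ∀ g ∈ W, MapsTo (S k g) (ball (0 : lp (fun _ : A => ℂ) ∞) r) (closedBall (c k g) r₄)) ∧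
      (∀ k, ∀ g ∈ W, ‖c k g‖ ≤ cbar) ∧ ¬ ChainLipschitz S W r θ Cc μ := by
  classical
  -- unit-ball currency `(c̄/r, r₄/r)` (leaf-04's `rateIneq_iff_unit`), then leaf-04's witness by contraposition
  have hθ' : cbar / r + r₄ / r ≤ θ := by rw [← add_div, div_le_iff₀ hr]; exact hθ
  rw [← div_mul_cancel₀ r₄ hr.ne', ← div_mul_cancel₀ cbar hr.ne'] at hμ
  have hnot : ¬ ∀ (F : lp (fun _ : A => ℂ) ∞ → lp (fun _ : A => ℂ) ∞) (c : lp (fun _ : A => ℂ) ∞),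
      DifferentiableOn ℂ F (ball 0 1) → MapsTo F (ball 0 1) (closedBall c (r₄ / r)) → ‖c‖ ≤ cbar / r →
      ∀ n : ℕ, ∀ x ∈ closedBall (0 : lp (fun _ : A => ℂ) ∞) θ, ∀ y ∈ closedBall (0 : lp (fun _ : A => ℂ) ∞) θ,
        ‖F^[n] x - F^[n] y‖ ≤ Cc * μ ^ n * ‖x - y‖ := by
    intro hclass
    obtain ⟨ρ, hρ, hlt⟩ := hμ
    exact (not_le.2 hlt) ((rateIneq_iff_unit hr).2
      (rateIneq_of_classChainBound β (div_nonneg hcbar hr.le) (div_pos hr₄ hr) hθ' hθ1 hclass) ρ hρ)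
  push Not at hnot
  obtain ⟨F, c₀, hFd, hFm, hc₀, n, x, hx, y, hy, hlt⟩ := hnot
  -- the dilated witness `z ↦ r • F (r⁻¹ • z)`
  have hr0 : (r : ℂ) ≠ 0 := Complex.ofReal_ne_zero.2 hr.ne'
  have hnr : ∀ z : lp (fun _ : A => ℂ) ∞, ‖(r : ℂ) • z‖ = r * ‖z‖ := fun z => by
    rw [norm_smul, Complex.norm_of_nonneg hr.le]
  have hnr' : ∀ z : lp (fun _ : A => ℂ) ∞, ‖(r : ℂ)⁻¹ • z‖ = r⁻¹ * ‖z‖ := fun z => by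
    rw [norm_smul, norm_inv, Complex.norm_of_nonneg hr.le]
  have hball : MapsTo (fun z : lp (fun _ : A => ℂ) ∞ => (r : ℂ)⁻¹ • z) (ball 0 r) (ball 0 1) := fun z hz => by
    rw [mem_ball_zero_iff] at hz ⊢
    rw [hnr', inv_mul_lt_iff₀ hr, mul_one]; exact hz
  have hFrd : DifferentiableOn ℂ (fun z : lp (fun _ : A => ℂ) ∞ => (r : ℂ) • F ((r : ℂ)⁻¹ • z)) (ball 0 r) :=
    (hFd.comp ((differentiable_id.const_smul ((r : ℂ)⁻¹)).differentiableOn) hball).const_smul (r : ℂ)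
  have hFrm : MapsTo (fun z : lp (fun _ : A => ℂ) ∞ => (r : ℂ) • F ((r : ℂ)⁻¹ • z)) (ball 0 r)
      (closedBall ((r : ℂ) • c₀) r₄) := by
    intro z hz
    have h := hFm (hball hz)
    rw [mem_closedBall, dist_eq_norm] at h ⊢
    rw [← smul_sub, hnr]
    calc r * ‖F ((r : ℂ)⁻¹ • z) - c₀‖ ≤ r * (r₄ / r) := mul_le_mul_of_nonneg_left h hr.le
      _ = r₄ := by field_simp
  have hcr : ‖(r : ℂ) • c₀‖ ≤ cbar := by
    rw [hnr]
    calc r * ‖c₀‖ ≤ r * (cbar / r) := mul_le_mul_of_nonneg_left hc₀ hr.le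
      _ = cbar := by field_simp
  -- conjugation of the iterates: `(r • F (r⁻¹ • ·))^[n] (r • z) = r • F^[n] z`
  have hsemi : Function.Semiconj (fun z : lp (fun _ : A => ℂ) ∞ => (r : ℂ) • z) F
      (fun z : lp (fun _ : A => ℂ) ∞ => (r : ℂ) • F ((r : ℂ)⁻¹ • z)) := by
    intro z
    simp only [smul_smul, inv_mul_cancel₀ hr0, one_smul]
  have hconj : ∀ z : lp (fun _ : A => ℂ) ∞,
      (fun z : lp (fun _ : A => ℂ) ∞ => (r : ℂ) • F ((r : ℂ)⁻¹ • z))^[n] ((r : ℂ) • z) = (r : ℂ) • F^[n] z :=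
    fun z => ((hsemi.iterate_right n) z).symm
  have hin : ∀ z ∈ closedBall (0 : lp (fun _ : A => ℂ) ∞) θ,
      (r : ℂ) • z ∈ closedBall (0 : lp (fun _ : A => ℂ) ∞) (θ * r) := fun z hz => by
    rw [mem_closedBall_zero_iff] at hz ⊢
    rw [hnr, mul_comm]; exact mul_le_mul_of_nonneg_right hz hr.le
  refine ⟨fun _ _ => fun z => (r : ℂ) • F ((r : ℂ)⁻¹ • z), fun _ _ => (r : ℂ) • c₀, fun _ _ _ => hFrd,
    fun _ _ _ => hFrm, fun _ _ _ => hcr, fun hCL => ?_⟩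
  obtain ⟨g, hg⟩ := hW
  have h := hCL g hg 0 n _ (hin x hx) _ (hin y hy)
  rw [evol_const, Nat.sub_zero, hconj, hconj, ← smul_sub, ← smul_sub, hnr, hnr] at h
  exact (not_le.2 hlt) (le_of_mul_le_mul_left (h.trans_eq (by ring)) hr)

/-- **IN PART 2's CURRENCY, `hμ` IS NECESSARY AND SUFFICIENT.**  For `A` inhabited (`β`), `W` inhabited, `0 < r`,
`0 ≤ c̄`, `0 < r₄`, `c̄ + r₄ ≤ θr`, `θ < 1`: the rate inequality on `[0, r₄]` holds **iff** every family of holomorphic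
step maps `S k g : B(0,r) → B̄(c k g, r₄)`, `‖c k g‖ ≤ c̄`, of `ℓ^∞(A;ℂ)` satisfies `ChainLipschitz S W r θ (1∕(1−θ²)) μ`
(→ PART 2 with `e = refl`; ← the previous theorem); least such `μ` = leaf-04's closed form `isLeast_rate_radius`. [folklore] -/
theorem rateIneq_iff_forall_chainLipschitz (β : A) {W : Set (ℕ → ℝ)} (hW : W.Nonempty) {r cbar r₄ θ μ : ℝ} (hr : 0 < r)
    (hcbar : 0 ≤ cbar) (hr₄ : 0 < r₄) (hθ : cbar + r₄ ≤ θ * r) (hθ1 : θ < 1) :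
    (∀ ρ ∈ Icc (0 : ℝ) r₄, (r₄ ^ 2 - ρ ^ 2) * r ≤ μ * r₄ * (r ^ 2 - (cbar + ρ) ^ 2)) ↔
      ∀ (S : ℕ → (ℕ → ℝ) → lp (fun _ : A => ℂ) ∞ → lp (fun _ : A => ℂ) ∞)
        (c : ℕ → (ℕ → ℝ) → lp (fun _ : A => ℂ) ∞),
        (∀ k, ∀ g ∈ W, DifferentiableOn ℂ (S k g) (ball (0 : lp (fun _ : A => ℂ) ∞) r)) →
        (∀ k, ∀ g ∈ W, MapsTo (S k g) (ball (0 : lp (fun _ : A => ℂ) ∞) r) (closedBall (c k g) r₄)) →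
        (∀ k, ∀ g ∈ W, ‖c k g‖ ≤ cbar) → ChainLipschitz S W r θ (1 / (1 - θ ^ 2)) μ := by
  constructor
  · intro hμ S c hSd hSm hc
    exact chainLipschitz_of_holoMaps_offCentre (LinearIsometryEquiv.refl ℂ (lp (fun _ : A => ℂ) ∞)) c hr hr₄ hθ
      hθ1 hμ hSd hSm hc
  · intro h
    by_contra hμ
    push Not at hμ
    obtain ⟨S, c, hSd, hSm, hc, hnot⟩ :=
      exists_offCentreMaps_not_chainLipschitz β hW (Cc := 1 / (1 - θ ^ 2)) hr hcbar hr₄ hθ hθ1 hμ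
    exact hnot (h S c hSd hSm hc)

end Summit.QuantumFields.BalabanUV.T4Continuum.NE9PolydiscChainOffCentreSharp
end
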